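import Mathlib
import Literature.Computability.AlgebraicComplexity.OrbitClosureWeights
import Literature.Computability.AlgebraicComplexity.OrbitCoordinateRingProofs
import Literature.Computability.AlgebraicComplexity.PlethysmLifting
import Literature.Computability.Complexity.OccurrenceObstructionsIPProofs
import Literature.NumberTheory.DiophantineGeometry.GLHighestWeight

/-!
# The seed-lift transfer: explicit padded highest-weight vectors from size-`n` seeds, with
# certified algebraic independence (tools + key identity + transfer theorem)

Wall-breaker axis k9 ("explicit padded-permanent highest-weight vectors for `stub_seedRichness`")
for crux `ValuativeGCT.ValuativeFlip` (stmt-ValiantsHypothesis-12624; the stub lives in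
`Cruxes/ValuativeFlip/Lines/big_cell_semigroup_floor.lean`).  No new definitions.  The padded
highest-weight vectors are the Kadish–Landsberg / BIP lifts `liftHWV n j F` of seeds
`F ∈ HWV_{μ*}(ℂ[Sym^n ℂ^{n²}])`, reduced modulo `I(GL · Q)`; the point of the file is that their VALUES
on padded `x_top`-linear forms are the seed values up to one nonzero constant
(`psl_exists_const_aeval_paddedForm_liftHWV`), so algebraic independence is INHERITED upward along
the lift from a `j`-free certificate (`psl_seedLift_transfer`; the permanent instance and the
reduction of `stub_seedRichness` are in `ValuativeGCTValuativeFlipSeedLiftPer.lean`).  Tools: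

* `psl_mk_mem_highestWeightSpace` — a `B`-semi-invariant `F ∈ ℂ[Sym^m]` of weight `χ` reduces to a
  highest-weight vector of weight `χ` in `ℂ[Δ_m(f)] = OrbitCoordRing f m` for EVERY form `f`
  (the quotient map is `GL`-equivariant).
* `psl_algebraicIndependent_mk_of_eval` — INDEPENDENCE CERTIFICATE: if the values of
  `G₀, …, G_D ∈ ℂ[Sym^m]` at a family of endomorphism-orbit points `M(x) · f` (`x ∈ ℂ^τ`, `M(x)` any
  matrix) are, up to nonzero constants, the values `R_i(x)` of algebraically independent
  polynomials `R_i ∈ ℂ[τ]`, then the classes of the `G_i` in `ℂ[Δ_m(f)]` are algebraically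
  independent (a relation among the classes lies in `I(GL · f) = ker(genericOrbitMap)`, hence
  vanishes at every `M · f`, hence gives a relation among the `R_i` on all of `ℂ^τ`).
* `psl_apply_le_one_of_iterPderiv_two_eq_zero` / `psl_iterPderiv_two_eq_zero` — over `ℂ`,
  `∂_i² q = 0` iff `q` has degree `≤ 1` in `x_i`; `psl_iterPderiv_two_linSubst_eq_zero` — this is
  preserved by substitutions not feeding `x_i` into other variables.
* `psl_twist_eq_factorial_mul_coeff_torus` — on forms of `x_top`-degree `≤ 1`, BIP's twist
  `X^e ↦ (e_top + j)!/e_top! · X^e` (Lemma 5.2, the price of evaluating a lifted highest-weight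
  vector on a padded form, `aeval_formCoeff_paddedForm_liftHWV`) is `j!` times the TORUS element
  `diag(1, …, 1, j + 1)`; `psl_aeval_formCoeff_linSubst_diagonal` — a highest-weight vector takes
  the torus out as the nonzero scalar `χ(t⁻¹)`.
* `psl_exists_const_aeval_paddedForm_liftHWV` — KEY IDENTITY: `(L F)(x_top^j · q♯) = c · F(q)` for
  every `x_top`-linear form `q` of degree `n`, one constant `c = (j!)^δ χ(t_j⁻¹) ≠ 0`.
* `psl_seedLift_transfer` — THE TRANSFER: seeds whose generic values on a polynomial family
  `𝓐(x) · q₀` of `x_top`-linear forms are algebraically independent, and a target form `Q` whose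
  endomorphism orbit contains the padded forms `x_top^j (𝓐(x) · q₀)♯`, give algebraically
  independent highest-weight vectors `[L F_i] ∈ ℂ[Δ_{n+j}(Q)]` of weight `(μ♯(n+j))*`.

Sources: Mulmuley–Sohoni 2001 §4–§5; Bürgisser–Ikenmeyer–Panova 2019 §5 (Lemma 5.2, Thm 5.4);
folklore.
-/

set_option linter.dupNamespace false

namespace Summit.ValiantsHypothesis.ValiantsHypothesis.Theorems.ValuativeFlip

open MvPolynomial
open scoped BigOperators Matrix
open Literature.NumberTheory.DiophantineGeometry Literature.Computability.AlgebraicComplexity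

noncomputable section

/-! ### Highest-weight vectors of `ℂ[Sym^m]` reduce to highest-weight vectors of `ℂ[Δ_m(f)]` -/

/-- A highest-weight vector `F` of weight `χ` of `coordRep σ ℂ m` (a `B`-semi-invariant polynomial
function on `Sym^m ℂ^σ`) reduces, modulo the vanishing ideal of the orbit of ANY form `f`, to a
highest-weight vector of weight `χ` of `orbitCoordRep f m` (the reduction map is `GL`-equivariant,
`orbitCoordSubst_mk`).  Mulmuley–Sohoni 2001 §5. [folklore] -/
theorem psl_mk_mem_highestWeightSpace {σ : Type*} [Fintype σ] [LinearOrder σ]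
    (f : MvPolynomial σ ℂ) (m : ℕ) (χ : Weight σ) {F : MvPolynomial (DegIdx σ m) ℂ}
    (hF : F ∈ highestWeightSpace (coordRep σ ℂ m) χ) :
    Ideal.Quotient.mk (orbitVanishingIdeal f m) F ∈ highestWeightSpace (orbitCoordRep f m) χ := by
  intro g hg
  rw [orbitCoordRep_apply, orbitCoordSubst_mk, ← coordRep_apply, hF g hg]
  exact map_smul (Ideal.Quotient.mkₐ ℂ (orbitVanishingIdeal f m)) (weightChar χ g) F

/-! ### Algebraic independence in `ℂ[Δ_m(f)]` certified on a polynomial family of `End`-orbit points -/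

/-- Elements of the vanishing ideal of the orbit vanish at every ENDOMORPHISM-orbit point `M · f`
(`M` any square matrix, invertible or not): `I(GL · f)` is the kernel of the generic orbit map
(`orbitVanishingIdeal_eq_ker_genericOrbitMap`), whose value at `M` is evaluation at `M · f`
(`aeval_genericOrbitMap`).  Mulmuley–Sohoni 2001 §4. [folklore] -/
theorem psl_aeval_formCoeff_linSubst_eq_zero_of_mem {σ : Type*} [Fintype σ] [DecidableEq σ]
    {f : MvPolynomial σ ℂ} {m : ℕ} {P : MvPolynomial (DegIdx σ m) ℂ}
    (hP : P ∈ orbitVanishingIdeal f m) (M : Matrix σ σ ℂ) :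
    aeval (formCoeff m (linSubst σ ℂ M f)) P = 0 := by
  rw [orbitVanishingIdeal_eq_ker_genericOrbitMap, RingHom.mem_ker] at hP
  rw [← aeval_genericOrbitMap f m P M]
  -- the generic value is zero
  have h0 : (aeval (fun d : DegIdx σ m => coeff d.1 (linSubst σ (MvPolynomial (σ × σ) ℂ)
      (Matrix.mvPolynomialX σ σ ℂ) (map (C : ℂ →+* MvPolynomial (σ × σ) ℂ) f))) P) = 0 := hP
  rw [h0, map_zero]

/-- **Independence certificate along a polynomial family of endomorphism-orbit points.**  Let
`G_i ∈ ℂ[Sym^m ℂ^σ]` and let `R_i ∈ ℂ[τ]` be ALGEBRAICALLY INDEPENDENT polynomials such that at every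
parameter `x ∈ ℂ^τ` some matrix `M` (invertible or not) has `G_i(M · f) = c_i · R_i(x)` for all `i`,
with constants `c_i ≠ 0`.  Then the classes of the `G_i` in the coordinate ring `ℂ[Δ_m(f)]` of the
orbit closure are algebraically independent: a polynomial relation `Φ` among the classes means
`Φ(G) ∈ I(GL · f)`, which vanishes at every `M · f` (`psl_aeval_formCoeff_linSubst_eq_zero_of_mem`),
so `Φ(c · R)` vanishes on `ℂ^τ`, so `Φ(c · R) = 0` (`MvPolynomial.funext`), so `Φ = 0` (scaling the
variables by nonzero constants does not change the support, `support_aeval_C_mul_X`).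
Mulmuley–Sohoni 2001 §4; folklore. -/
theorem psl_algebraicIndependent_mk_of_eval {σ : Type*} [Fintype σ] [DecidableEq σ]
    {ι τ : Type*} (f : MvPolynomial σ ℂ) (m : ℕ) (G : ι → MvPolynomial (DegIdx σ m) ℂ)
    (R : ι → MvPolynomial τ ℂ) (hR : AlgebraicIndependent ℂ R) (c : ι → ℂ) (hc : ∀ i, c i ≠ 0)
    (h : ∀ x : τ → ℂ, ∃ M : Matrix σ σ ℂ, ∀ i,
      aeval (formCoeff m (linSubst σ ℂ M f)) (G i) = c i * eval x (R i)) :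
    AlgebraicIndependent ℂ fun i => Ideal.Quotient.mk (orbitVanishingIdeal f m) (G i) := by
  classical
  rw [algebraicIndependent_iff] at hR ⊢
  intro Φ hΦ
  -- the scaled relation `Φ' := Φ(c • X)` has the same support as `Φ`
  set Φ' : MvPolynomial ι ℂ := aeval (fun i : ι => C (c i) * X i) Φ with hΦ'
  suffices hzero : Φ' = 0 by
    have hsupp := support_aeval_C_mul_X c hc Φ
    rw [← hΦ', hzero, support_zero] at hsupp
    exact support_eq_empty.mp hsupp.symm
  apply hR
  apply MvPolynomial.funext
  intro x
  rw [map_zero]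
  obtain ⟨M, hM⟩ := h x
  -- `Φ(G) ∈ I(GL · f)`
  have hmem : aeval G Φ ∈ orbitVanishingIdeal f m := by
    rw [← Ideal.Quotient.eq_zero_iff_mem, ← Ideal.Quotient.mkₐ_eq_mk ℂ, ← AlgHom.comp_apply,
      comp_aeval]
    exact hΦ
  have hvan := psl_aeval_formCoeff_linSubst_eq_zero_of_mem hmem M
  rw [← AlgHom.comp_apply, comp_aeval] at hvan
  -- evaluate `Φ'(R)` at `x`
  have h1 : eval x (aeval R Φ') = aeval (fun i => c i * eval x (R i)) Φ := by
    have hfg : (fun i => aeval (fun i' => aeval x (R i')) (C (c i) * X i : MvPolynomial ι ℂ)) =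
        fun i => c i * eval x (R i) := by
      funext i
      simp only [map_mul, aeval_C, aeval_X, Algebra.algebraMap_self_apply]
      rfl
    change aeval x (aeval R (aeval (fun i : ι => C (c i) * X i) Φ)) = _
    rw [← AlgHom.comp_apply, comp_aeval, ← AlgHom.comp_apply, comp_aeval, hfg]
  rw [h1]
  have h2 : (fun i => c i * eval x (R i)) = fun i => aeval (formCoeff m (linSubst σ ℂ M f)) (G i) :=
    funext fun i => (hM i).symm
  rw [h2]
  exact hvan

/-! ### Degree `≤ 1` in one variable, via the second derivative (characteristic zero) -/

/-- If `∂_i² q = 0` then every monomial of `q` has degree `≤ 1` in `x_i` (characteristic zero: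
the coefficient of `x^{e - 2ε_i}` in `∂_i² q` is `e_i (e_i - 1) · coeff_e q`). [folklore] -/
theorem psl_apply_le_one_of_iterPderiv_two_eq_zero {σ : Type*} [DecidableEq σ]
    {q : MvPolynomial σ ℂ} (i : σ) (hq : iterPderiv i 2 q = 0) :
    ∀ e ∈ q.support, e i ≤ 1 := by
  classical
  intro e he
  by_contra hlt
  push Not at hlt
  have hexp : iterPderiv i 2 q =
      ∑ e' ∈ q.support, monomial (e' - Finsupp.single i 2) (coeff e' q * ((e' i).descFactorial 2 : ℕ)) := by
    conv_lhs => rw [← q.support_sum_monomial_coeff, map_sum]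
    exact Finset.sum_congr rfl fun e' _ => iterPderiv_monomial i 2 e' _
  have hcoeff := congrArg (coeff (e - Finsupp.single i 2)) hq
  rw [hexp, coeff_sum, coeff_zero] at hcoeff
  rw [Finset.sum_eq_single e] at hcoeff
  · rw [coeff_monomial, if_pos rfl] at hcoeff
    have h1 : coeff e q ≠ 0 := mem_support_iff.mp he
    have h2 : (((e i).descFactorial 2 : ℕ) : ℂ) ≠ 0 := by
      rw [Nat.cast_ne_zero, Ne, Nat.descFactorial_eq_zero_iff_lt]
      omega
    exact (mul_ne_zero h1 h2) hcoeff
  · intro e' he' hne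
    rw [coeff_monomial]
    by_cases hlt' : e' i < 2
    · rw [(Nat.descFactorial_eq_zero_iff_lt.mpr hlt'), Nat.cast_zero, mul_zero, ite_self]
    · rw [if_neg]
      intro hEq
      apply hne
      push Not at hlt'
      ext l
      have hl := congrArg (fun f : σ →₀ ℕ => f l) hEq
      simp only [Finsupp.coe_tsub, Pi.sub_apply, Finsupp.single_apply] at hl
      split_ifs at hl with hil
      · subst hil; omega
      · omega
  · intro hne
    exact absurd he hne

/-- Conversely, if every monomial of `q` has degree `≤ 1` in `x_i` then `∂_i² q = 0`. [folklore] -/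
theorem psl_iterPderiv_two_eq_zero {σ : Type*} [DecidableEq σ] {q : MvPolynomial σ ℂ} (i : σ)
    (hq : ∀ e ∈ q.support, e i ≤ 1) : iterPderiv i 2 q = 0 := by
  classical
  conv_lhs => rw [← q.support_sum_monomial_coeff, map_sum]
  refine Finset.sum_eq_zero fun e he => ?_
  rw [iterPderiv_monomial, (Nat.descFactorial_eq_zero_iff_lt.mpr (by have := hq e he; omega)),
    Nat.cast_zero, mul_zero, monomial_zero]

/-- A substitution `x_l ↦ ∑_p B_{p l} x_p` that does not feed `x_i` into the other variables
(`B_{i l} = 0` for `l ≠ i`) preserves "degree `≤ 1` in `x_i`": `∂_i² (B · q) = B_{ii}² · B · ∂_i² q`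
(`iterPderiv_linSubst_of_row_eq`). [folklore] -/
theorem psl_iterPderiv_two_linSubst_eq_zero {σ : Type*} [Fintype σ] [DecidableEq σ]
    (B : Matrix σ σ ℂ) (i : σ) (hB : ∀ l, l ≠ i → B i l = 0) {q : MvPolynomial σ ℂ}
    (hq : iterPderiv i 2 q = 0) : iterPderiv i 2 (linSubst σ ℂ B q) = 0 := by
  rw [iterPderiv_linSubst_of_row_eq B i hB 2 q, hq, map_zero, smul_zero]

/-! ### BIP's twist on `x_top`-linear forms is a torus element -/

/-- Coefficients of a diagonal substitution: `coeff_e (diag(β) · q) = (∏_l β_l^{e_l}) coeff_e q`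
(`linSubst_diagonal_monomial`). Fulton–Harris §15.5. [folklore] -/
theorem psl_coeff_linSubst_diagonal {σ : Type*} [Fintype σ] [DecidableEq σ] (β : σ → ℂ)
    (q : MvPolynomial σ ℂ) (e : σ →₀ ℕ) :
    coeff e (linSubst σ ℂ (Matrix.diagonal β) q) = (e.prod fun l n => β l ^ n) * coeff e q := by
  classical
  conv_lhs => rw [← q.support_sum_monomial_coeff, map_sum]
  simp only [linSubst_diagonal_monomial, coeff_sum, coeff_smul, coeff_monomial, smul_eq_mul,
    mul_ite, mul_zero]
  rw [Finset.sum_ite_eq']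
  split_ifs with h
  · rfl
  · rw [notMem_support_iff.mp h, mul_zero]

/-- **The twist is a torus element on `x_i`-linear forms.**  If every monomial of `q` has degree
`≤ 1` in `x_i`, then BIP's twist `coeff_e q ↦ (e_i + j)!/e_i! · coeff_e q` (Lemma 5.2; the factor by
which a lifted highest-weight vector sees a padded form, `aeval_formCoeff_paddedForm_liftHWV`)
equals `j!` times the diagonal substitution `x_i ↦ (j + 1) x_i` (other variables fixed):
`e_i = 0` gives `j!`, `e_i = 1` gives `(j + 1)!= j! (j + 1)`. [folklore] -/
theorem psl_twist_eq_factorial_mul_coeff_torus {σ : Type*} [Fintype σ] [DecidableEq σ]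
    {q : MvPolynomial σ ℂ} (i : σ) (hq : ∀ e ∈ q.support, e i ≤ 1) (j : ℕ) (e : σ →₀ ℕ) :
    (((e i + j).descFactorial j : ℕ) : ℂ) * coeff e q =
      (j.factorial : ℂ) * coeff e (linSubst σ ℂ
        (Matrix.diagonal fun l => if l = i then ((j : ℂ) + 1) else 1) q) := by
  classical
  rw [psl_coeff_linSubst_diagonal]
  have hprod : (e.prod fun l n => (if l = i then ((j : ℂ) + 1) else 1) ^ n) = ((j : ℂ) + 1) ^ (e i) := by
    rw [Finsupp.prod]
    rw [Finset.prod_eq_single i]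
    · rw [if_pos rfl]
    · intro l _ hl
      rw [if_neg hl, one_pow]
    · intro hi
      rw [Finsupp.notMem_support_iff.mp hi, pow_zero]
  rw [hprod]
  by_cases h0 : coeff e q = 0
  · rw [h0, mul_zero, mul_zero, mul_zero]
  · have hle := hq e (mem_support_iff.mpr h0)
    interval_cases hei : e i
    · rw [zero_add, Nat.descFactorial_self, pow_zero, one_mul]
    · have h := Nat.succ_descFactorial j j
      rw [Nat.add_sub_cancel_left, one_mul, Nat.descFactorial_self] at h
      rw [add_comm, h, pow_one]
      push_cast
      ring

/-- **A highest-weight vector takes a torus element out as a scalar.**  For `F ∈ ℂ[Sym^m]` a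
`B`-semi-invariant of weight `χ` (`coordRep`, `(g · F)(v) = F(g⁻¹ v)`), a form `h`, and a diagonal
invertible `t = diag(β)`: `F(t · h) = χ(t⁻¹) · F(h)` (`aeval_formCoeff_coordSubst` at `g = t⁻¹`).
Goodman–Wallach §3.2.1. [folklore] -/
theorem psl_aeval_formCoeff_linSubst_diagonal {σ : Type*} [Fintype σ] [LinearOrder σ] (m : ℕ)
    (χ : Weight σ) {F : MvPolynomial (DegIdx σ m) ℂ} (hF : F ∈ highestWeightSpace (coordRep σ ℂ m) χ)
    (β : σ → ℂ) (hβ : ∀ l, β l ≠ 0) (h : MvPolynomial σ ℂ) :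
    aeval (formCoeff m (linSubst σ ℂ (Matrix.diagonal β) h)) F =
      weightChar χ (torusElt β hβ)⁻¹ * aeval (formCoeff m h) F := by
  have hdiag : IsDiagonalGL (torusElt β hβ)⁻¹ := (torusSubgroup σ ℂ).inv_mem (isDiagonalGL_torusElt β hβ)
  have key := aeval_formCoeff_coordSubst m (torusElt β hβ)⁻¹ h F
  rw [inv_inv, linSubstRep_apply, coe_torusElt, ← coordRep_apply, hF _ hdiag.isUpperTriangular,
    map_smul, smul_eq_mul] at key
  exact key.symm


/-! ### The value of a lifted highest-weight vector on a padded `x_top`-linear form -/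

section Transfer

open Literature.Computability.Complexity (liftHWV paddedForm rowLift partitionWeightLex topMatIdx
  liftHWV_mem_highestWeightSpace aeval_formCoeff_paddedForm_liftHWV size_partitionWeightLex')

/-- **KEY IDENTITY (explicit values of the padded highest-weight vectors).**  Let `F ∈ ℂ[Sym^n ℂ^{n²}]`
be a highest-weight vector of weight `χ` and degree `δ`, and `L F = liftHWV n j F ∈ ℂ[Sym^{n+j} ℂ^{(n+j)²}]`
its Kadish–Landsberg / BIP lift.  There is ONE nonzero constant `c = (j!)^δ · χ(t_j⁻¹)`,
`t_j = diag(1, …, 1, j + 1)`, such that for EVERY form `q` of degree `n` in the `n²` variables that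
is linear in the top variable `x_top`:  `(L F)(x_top^j · q♯) = c · F(q)` (`q♯ = q` placed on the
final lexicographic segment, `paddedForm`).  Indeed `(L F)(x_top^j q♯) = F(Δ_j q)` (BIP Thm 5.4 with
Lemma 5.2, `aeval_formCoeff_paddedForm_liftHWV`), the twist `Δ_j` is `j! · t_j` on `x_top`-linear
forms (`psl_twist_eq_factorial_mul_coeff_torus`), `F` is homogeneous of degree `δ`, and a
highest-weight vector takes the torus element out as `χ(t_j⁻¹)` (`psl_aeval_formCoeff_linSubst_diagonal`).
So on padded `x_top`-linear forms the lifted (padded) highest-weight vector is, up to a harmless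
constant, the ORIGINAL seed evaluated on the inner form — no twist.
[BIP 2019 §5; this file] -/
theorem psl_exists_const_aeval_paddedForm_liftHWV (n j : ℕ) [NeZero n] [NeZero (n + j)]
    (χ : Weight (MatIdx n)) {F : MvPolynomial (DegIdx (MatIdx n) n) ℂ}
    (hF : F ∈ highestWeightSpace (coordRep (MatIdx n) ℂ n) χ) {δ : ℕ} (hFδ : F.IsHomogeneous δ) :
    ∃ c : ℂ, c ≠ 0 ∧ ∀ q : MvPolynomial (MatIdx n) ℂ, q.IsHomogeneous n →
      (∀ e ∈ q.support, e (topMatIdx n) ≤ 1) →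
      aeval (formCoeff (n + j) (paddedForm n j q)) (liftHWV n j F) = c * aeval (formCoeff n q) F := by
  classical
  set β : MatIdx n → ℂ := fun l => if l = topMatIdx n then ((j : ℂ) + 1) else 1 with hβdef
  have hβ : ∀ l, β l ≠ 0 := by
    intro l
    simp only [hβdef]
    split_ifs
    · exact Nat.cast_add_one_ne_zero j
    · exact one_ne_zero
  have hup : IsUpperTriangular (torusElt β hβ)⁻¹ :=
    ((torusSubgroup (MatIdx n) ℂ).inv_mem (isDiagonalGL_torusElt β hβ)).isUpperTriangular
  refine ⟨(j.factorial : ℂ) ^ δ * weightChar χ (torusElt β hβ)⁻¹,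
    mul_ne_zero (pow_ne_zero _ (Nat.cast_ne_zero.mpr (Nat.factorial_ne_zero j)))
      (weightChar_ne_zero χ hup), ?_⟩
  intro q hq hq1
  rw [aeval_formCoeff_paddedForm_liftHWV j hq F]
  have hfun : (fun e : DegIdx (MatIdx n) n =>
      (((e.1 (topMatIdx n) + j).descFactorial j : ℕ) : ℂ) * coeff e.1 q) =
      fun e => (j.factorial : ℂ) • formCoeff n (linSubst (MatIdx n) ℂ (Matrix.diagonal β) q) e := by
    funext e
    rw [formCoeff_apply, smul_eq_mul]
    exact psl_twist_eq_factorial_mul_coeff_torus (topMatIdx n) hq1 j e.1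
  rw [hfun]
  have hscale := algHom_apply_eq_pow_smul_of_isHomogeneous
    (aeval fun e : DegIdx (MatIdx n) n =>
      (j.factorial : ℂ) • formCoeff n (linSubst (MatIdx n) ℂ (Matrix.diagonal β) q) e)
    (aeval (formCoeff n (linSubst (MatIdx n) ℂ (Matrix.diagonal β) q))) (j.factorial : ℂ)
    (fun e => by rw [aeval_X, aeval_X]) hFδ
  rw [hscale, psl_aeval_formCoeff_linSubst_diagonal n χ hF β hβ q, smul_eq_mul, mul_assoc]

/-- **SEED-LIFT TRANSFER (the axis theorem).**  Data at the inner size `n`: a partition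
`μ ⊢ n·d` with at most `n²` rows; an inner form `q₀` of degree `n` (for the crux: `per_n`); a
POLYNOMIAL FAMILY of endomorphisms `𝓐(x)` (`x ∈ ℂ^τ`) such that every `𝓐(x) · q₀` is linear in the top
variable; a target form `Q` of degree `n + j` whose ENDOMORPHISM orbit contains every padded form
`x_top^j · (𝓐(x) · q₀)♯` (for the crux: `Q = X₀₀^j per_n`, `paddedPerFormLex ℂ n (n+j)`); and seeds
`F_i ∈ HWV_{μ*}(ℂ[Sym^n ℂ^{n²}])` whose generic values `x ↦ F_i(𝓐(x) · q₀)` are ALGEBRAICALLY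
INDEPENDENT polynomials in `x`.  Conclusion at size `n + j`: the classes of the lifts `liftHWV n j F_i`
in the coordinate ring `ℂ[Δ_{n+j}(Q)]` are highest-weight vectors of weight `(μ♯(n+j))*`
(`partitionWeightLex (n+j) (rowLift μ j)`) and are ALGEBRAICALLY INDEPENDENT — explicit padded
highest-weight vectors with a certified transcendence count, for every padding `j`, from one
`j`-free certificate.  (Key identity `psl_exists_const_aeval_paddedForm_liftHWV` + independence
certificate `psl_algebraicIndependent_mk_of_eval` + `liftHWV_mem_highestWeightSpace`.)
[this file; BIP 2019 §5; IP 2017 Prop. 2.6(b)] -/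
theorem psl_seedLift_transfer (n j : ℕ) [NeZero n] [NeZero (n + j)] {d : ℕ}
    (μ : Nat.Partition (n * d)) (hμ : μ.parts.card ≤ n * n)
    (q₀ : MvPolynomial (MatIdx n) ℂ) (hq₀ : q₀.IsHomogeneous n)
    (Q : MvPolynomial (MatIdx (n + j)) ℂ)
    {τ : Type*} (𝓐 : Matrix (MatIdx n) (MatIdx n) (MvPolynomial τ ℂ))
    (hdeg : ∀ x : τ → ℂ, ∀ e ∈ (linSubst (MatIdx n) ℂ (𝓐.map (eval x)) q₀).support,
      e (topMatIdx n) ≤ 1)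
    (hmem : ∀ x : τ → ℂ, paddedForm n j (linSubst (MatIdx n) ℂ (𝓐.map (eval x)) q₀) ∈
      endOrbit (MatIdx (n + j)) ℂ Q)
    {ι : Type*} (F : ι → MvPolynomial (DegIdx (MatIdx n) n) ℂ)
    (hF : ∀ i, F i ∈ highestWeightSpace (coordRep (MatIdx n) ℂ n) (partitionWeightLex n μ))
    (hind : AlgebraicIndependent ℂ fun i =>
      aeval (fun ab : MatIdx n × MatIdx n => 𝓐 ab.1 ab.2) (genericOrbitMap q₀ n (F i))) :
    (∀ i, Ideal.Quotient.mk (orbitVanishingIdeal Q (n + j)) (liftHWV n j (F i)) ∈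
        highestWeightSpace (orbitCoordRep Q (n + j)) (partitionWeightLex (n + j) (rowLift μ j))) ∧
      AlgebraicIndependent ℂ fun i =>
        Ideal.Quotient.mk (orbitVanishingIdeal Q (n + j)) (liftHWV n j (F i)) := by
  classical
  refine ⟨fun i => psl_mk_mem_highestWeightSpace Q (n + j) _
    (liftHWV_mem_highestWeightSpace μ hμ j (hF i)), ?_⟩
  -- a weight pins the degree: the seeds are forms of degree `d`
  have hFδ : ∀ i, (F i).IsHomogeneous d := fun i =>
    isHomogeneous_of_mem_highestWeightSpace (NeZero.ne n) (hF i) (size_partitionWeightLex' μ hμ)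
  choose c hc0 hc using fun i =>
    psl_exists_const_aeval_paddedForm_liftHWV n j (partitionWeightLex n μ) (hF i) (hFδ i)
  refine psl_algebraicIndependent_mk_of_eval Q (n + j) (fun i => liftHWV n j (F i))
    (fun i => aeval (fun ab : MatIdx n × MatIdx n => 𝓐 ab.1 ab.2) (genericOrbitMap q₀ n (F i)))
    hind c hc0 fun x => ?_
  obtain ⟨M, hM⟩ := hmem x
  refine ⟨M, fun i => ?_⟩
  have heval : eval x (aeval (fun ab : MatIdx n × MatIdx n => 𝓐 ab.1 ab.2)
      (genericOrbitMap q₀ n (F i))) =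
      aeval (formCoeff n (linSubst (MatIdx n) ℂ (𝓐.map (eval x)) q₀)) (F i) := by
    rw [show eval x (aeval (fun ab : MatIdx n × MatIdx n => 𝓐 ab.1 ab.2)
        (genericOrbitMap q₀ n (F i))) =
        eval (fun ab : MatIdx n × MatIdx n => eval x (𝓐 ab.1 ab.2)) (genericOrbitMap q₀ n (F i)) from
      eval₂Hom_bind₁ (RingHom.id ℂ) x _ _]
    exact eval_genericOrbitMap q₀ n (F i) (𝓐.map (eval x))
  dsimp only at hM
  rw [hM, hc i _ (linSubst_isHomogeneous _ hq₀) (hdeg x), heval]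

end Transfer

end

end Summit.ValiantsHypothesis.ValiantsHypothesis.Theorems.ValuativeFlip
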